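import Mathlib
import HarnessLib
import Summits.HubbardSuperconductivity.HubbardSuperconductivity.Theorems.ComplexGFFStiffnessHypACumulantTunedRepresentation
import Literature.MathematicalPhysics.StatisticalMechanics.TunedFlowLastScale

/-!
# Crux `HypALocalTwoPoint`, line `gnv` — the TUNED SYSTEM of the free-energy assembly:
# the concrete `h`-indexed renormalisation-group data satisfy the dischargeable hypotheses of
# `RGFlow.freeEnergySizes_of_isTunedQ`

Route `route-HubbardSuperconductivity-ComplexGFFStiffness`, crux item stmt-HubbardSuperconductivity-19155,
registered stub `stub_twoPointGivenZ`, census F1 (assembly of `FreeEnergyBounds`) of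
FREEENERGY-PLAN-cgffstiff2-g1 §3, part (iii-a).  The abstract assembly
(`Literature/Dynamics/Hyperbolic/RGFlowStableManifoldFreeEnergyDifferences`) is indexed by the tuned
seed `x₀ ∈ E_0` (`ℋ`, `‖x₀‖ ≤ ρ`); the concrete system of [ABKM19] Ch. 12 on the torus `(ℤ/L^N)^d` is
`A^{x₀} = rgA (𝒞_{𝟙+q(x₀)})`, `B^{x₀} = rgBT (q(x₀))`, `S^{x₀} = rgSQ (𝒞_{𝟙+q(x₀)})`, initial activity
`y₀^{𝒦}(x₀) = initAct 𝒦 x₀`, predicates `activityNormLE`, tuning map `q = hamTuningMap ρ`, and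
last-scale functional `Φ(x₀, y) = ∫ y(Λ, φ) μ_{N+1}^{(q(x₀))}(dφ)`.  This file discharges, under the
[ABKM19] package at fixed `(L, N)` (general `d`), the hypotheses of the abstract assembly that the
tree already controls `N`-uniformly:

* `activityNormLE_nonneg_abkm` — bounds of the predicates are nonnegative (`hQnn`, every scale);
* `isRGStepQ_tunedSystem` — Theorem 6.8 for every seed in the ball (`hT`);
* `norm_lastScaleInt_sub_le`, `norm_lastScaleInt_secondDiff_le` — the `K_N`-slot of `Φ`
  (`hΦ1`, `hΦ4`, constant `c_I = A⁻¹A_𝒫`, from `TunedFlowLastScale`);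
(The identity `I(𝒦, x₀) = 1 + Φ(x₀, y_N)` along a tuned trajectory is the sequel
`…HypALocalTwoPointTunedSystemIntegral`.)

What is NOT here (taken as hypotheses downstream = census F4/F5): the `q`-slots `(12.52)`, `(12.53)`
with `N`-uniform constants and their second-order versions, the parallelogram second differences of
`S_k` in the state, and the `q`-slot of `Φ` (Lemma 8.4 at the last scale).  All proved, no `sorry`.

## References
* S. Adams, S. Buchholz, R. Kotecký, S. Müller, arXiv:1910.13564, Ch. 4.2–4.4, Ch. 12, Lemma 12.6,
  Theorem 2.2 [AdamsBuchholzKoteckyMuller2019].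
-/

noncomputable section

-- `Summit.<Summit>.<Problem>`: single-conjunct summit, the duplicate component is mandated (D-0017).
set_option linter.dupNamespace false

namespace Summit.HubbardSuperconductivity.HubbardSuperconductivity.Theorems.ComplexGFF

open scoped BigOperators ComplexConjugate
open Real Set Finset MeasureTheory
open Literature.MathematicalPhysics.StatisticalMechanics.GradientRG
open Literature.MathematicalPhysics.StatisticalMechanics.GradientFRD
  (fourierCoeff cExt cExt_of_mem IsElliptic IsUnitSymm InShell iterDiff supNorm conv ellOp isElliptic_one)
open Literature.MathematicalPhysics.StatisticalMechanics.TorusPolymer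
  (IsPolymer numBlocks blockOf boxCorner isPolymer_blockOf isConn_blockOf pcirc)
open Literature.Barriers.CriticalPhenomena.LongRangePhi4.Polymer (IsConn components)
open Literature.MathematicalPhysics.QuantumFieldTheory
open Literature.Dynamics.Hyperbolic

variable {d M : ℕ} [NeZero M]

/-! ## Nonnegativity of the activity-norm bounds at every scale -/

/-- The bound of `activityNormLE P k y c` is nonnegative at EVERY scale `k` (the weak norm reads the
connected block `B_k(0)`, a `k`-polymer for any `k` on an odd torus; the weight is positive) — the
hypothesis `hQnn` of `RGFlow.freeEnergySizes_of_isTunedQ`. ([ABKM19] (6.50).) -/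
theorem activityNormLE_nonneg_abkm {P : NormParams d M} (hA : 0 < P.A) (hMo : Odd M) {k : ℕ}
    (hs : Odd (P.L ^ k)) {K : activitySpace P k} {C : ℝ} (hK : activityNormLE P k K C) : 0 ≤ C := by
  have h1 := (hK (blockOf (P.L ^ k) 0) (isPolymer_blockOf _ _) (isConn_blockOf hMo hs 0)) 0
  have h2 : 0 ≤ C * P.aFactor k (blockOf (P.L ^ k) 0) :=
    (mul_nonneg_iff_of_pos_right (P.W.weight_pos k _ 0)).1 ((tayNorm_nonneg _ _ _ _).trans h1)
  exact (mul_nonneg_iff_of_pos_right (WeakNormLE.aFactor_pos hA k _)).1 h2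

section Package

variable {L N Mord R n ñ : ℕ} {θbar lam μ δ₁ δ₀ A𝒫 : ℝ}
    {𝒞 : Matrix (Fin d) (Fin d) ℝ → ℕ → (Fin d → ZMod M) → ℝ} {Mc : ℕ → ℝ}
    {Cα : (Fin d → ℕ) → ℕ → ℝ} {c C : ℝ} {Cℓ : ℕ → ℝ}

set_option maxHeartbeats 1600000 in
/-- **Theorem 6.8 for every seed** (`hT` of the abstract assembly; the tuning map `hamTuningMap ρ`
retracts onto the `T₀`-ball, so no condition on `x₀` is needed): the steps `(rgA, rgBT, rgSQ)` at the kernels `𝒞_{𝟙+q(x₀)}`, `q = hamTuningMap ρ`, satisfy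
`RGFlow.IsRGStepQ N r (3/4) (L^d C_{8.7} A_𝒫 A⁻¹) σ(r)` — the tree's `isRGStepQ_abkm_of_stepKernelBounds`
fed by `stepKernelBounds_family_of_torusFRD`, `N`-uniform constants. ([ABKM19] Theorem 6.8.) -/
theorem isRGStepQ_tunedSystem {h : ℝ} [Fact (0 < h)] [Fact (0 < L)]
    (hd : 3 ≤ d) (hMord : 1 ≤ Mord) (hMR : Mord ≤ R) (hLodd : Odd L) (hL : 2 ^ (d + 3) + 16 * R ≤ L)
    (hR2 : 2 ≤ R) (hM : M = L ^ N)
    (hθbar : 0 < θbar) (hlam : 0 < lam) (hn : 2 * Mord ≤ n) (hn2 : 2 ≤ n) (hnñ : n ≤ ñ)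
    (hc : 0 < c) (hC1 : 0 ≤ Cℓ 1)
    (hallA : ∀ A : Matrix (Fin d) (Fin d) ℝ, IsElliptic (1 / 2 : ℝ) 2 A →
        (∀ k, 1 ≤ k → k ≤ N + 1 →
          ∑ x : Fin d → ZMod M, 𝒞 A k x = 0 ∧ ∀ x, 𝒞 A k (-x) = 𝒞 A k x) ∧
        (∀ k, 1 ≤ k → k ≤ N + 1 → ∀ φ : (Fin d → ZMod M) → ℝ, ∑ x, φ x = 0 →
          0 ≤ ∑ x, ∑ y, φ x * 𝒞 A k (x - y) * φ y) ∧
        (∀ φ : (Fin d → ZMod M) → ℝ, ∑ x, φ x = 0 →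
          ellOp A (conv (fun x => ∑ k ∈ Finset.Icc 1 (N + 1), 𝒞 A k x) φ) = φ) ∧
        (∀ k, 1 ≤ k → k ≤ N → Mc k ≤ 0 ∧
          ∀ x : Fin d → ZMod M, ((L : ℝ) ^ k) / 2 ≤ (supNorm x : ℝ) →
            𝒞 A k x = Mc k) ∧
        (∀ k, 1 ≤ k → k ≤ N + 1 → ∀ B : Matrix (Fin d) (Fin d) ℝ, IsUnitSymm B →
          (∃ ε : ℝ, 0 < ε ∧ ∀ x : Fin d → ZMod M,
            ContDiffOn ℝ ⊤ (fun s : ℝ => 𝒞 (A + s • B) k x) (Set.Ioo (-ε) ε)) ∧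
          ∀ α : Fin d → ℕ, ∑ i, α i ≤ n → ∀ ℓ : ℕ, ∀ x : Fin d → ZMod M,
            abs (iteratedDeriv ℓ (fun s : ℝ => iterDiff α (𝒞 (A + s • B) k) x) 0)
              ≤ Cα α ℓ / (L : ℝ) ^ ((k - 1) * (d - 2 + ∑ i, α i))) ∧
        (∀ k, 1 ≤ k → k ≤ N + 1 → ∀ j : ℕ, ∀ κ : Fin d → ZMod M, κ ≠ 0 → InShell L j κ →
          (j < k →
            c / (L : ℝ) ^ (2 * (d + ñ) + 1) * (L : ℝ) ^ (2 * j)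
                / (L : ℝ) ^ ((k - j) * (d - 1 + n)) ≤ (fourierCoeff (𝒞 A k) κ).re ∧
            ‖fourierCoeff (𝒞 A k) κ‖
              ≤ C * (L : ℝ) ^ (2 * (d + ñ) + 1) * (L : ℝ) ^ (2 * j)
                  / (L : ℝ) ^ ((k - j) * (d - 1 + n))) ∧
          (k ≤ j →
            c / (L : ℝ) ^ (2 * (d + ñ) + 1) * (L : ℝ) ^ (2 * k)
                ≤ (fourierCoeff (𝒞 A k) κ).re ∧
            ‖fourierCoeff (𝒞 A k) κ‖ ≤ C * (L : ℝ) ^ (2 * k)) ∧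
          ∀ B : Matrix (Fin d) (Fin d) ℝ, IsUnitSymm B → ∀ ℓ : ℕ, 1 ≤ ℓ →
            (j < k →
              ‖iteratedDeriv ℓ (fun s : ℝ => fourierCoeff (𝒞 (A + s • B) k) κ) 0‖
                ≤ Cℓ ℓ * (L : ℝ) ^ (2 * (d + ñ) + 1) * (L : ℝ) ^ (2 * j)
                    / (L : ℝ) ^ ((k - j) * (d - 1 + ñ))) ∧
            (k ≤ j →
              ‖iteratedDeriv ℓ (fun s : ℝ => fourierCoeff (𝒞 (A + s • B) k) κ) 0‖
                ≤ Cℓ ℓ * (L : ℝ) ^ (2 * k))))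
    (hB : AbkmWeightBounds L N Mord R n θbar lam μ δ₁ δ₀ A𝒫 (fun j => 𝒞 1 j)
      (abkmWeightData L N Mord R θbar (schedDelta δ₀ δ₁ N) fun j => 𝒞 1 j))
    {pT r₀ : ℕ} (hp : d / 2 + 2 ≤ pT) (hpM : pT + d ≤ Mord) (hr₀ : 3 ≤ r₀)
    (hδ₀ : 0 < δ₀) (hδ₁ : 0 < δ₁) (hh0 : hZeroSq d R δ₀ δ₁ ≤ h ^ 2)
    (hh2 : secondDiffConst (fun θ' => Cα θ' 0) ≤ h ^ 2)
    -- the tuning ball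
    {θ : ℝ} (hθ0 : 0 ≤ θ) (hθ : θ < θbar)
    {T₀ : ℝ} (hT₀ : T₀ ≤ 1 / 2) (hKT₀ : shellRatioConst c (Cℓ 1) (L : ℝ) d ñ * T₀ ≤ Real.log (1 + θ))
    {A𝒫' : ℝ} (hA𝒫' : weightIntConstRho θbar θ (traceConst d Mord R lam (derivSum d n fun θ' _ => Cα θ' 0)) = A𝒫')
    -- the side conditions of Theorem 6.8 (`RGStepABKMQ`), at `A_𝒫' = A_𝒫(θ)`
    {A : ℝ} (hA1 : 1 ≤ A) (hA𝒫A : A𝒫' ≤ A)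
    (hsmall : (2 : ℝ) ^ (L ^ d) * (A𝒫' * A ^ (-(1 - (1 + 1 / ((2 * (2 ^ d + 1) + 6 : ℝ) ^ d))⁻¹) : ℝ)) ≤ 1)
    {r : ℝ} (hr0 : 0 ≤ r) (hr : r ≤ 1 / 64)
    (hv : vABKM d R A A𝒫' r ≤ 1 / 64) (hωA : omegaABKM d R A A𝒫' r * A ^ 2 ≤ 1)
    (hc3A : (kappaABKM d R A A𝒫' r) ^ (L ^ d) * ((2 * (2 * (kappaABKM d R A A𝒫' r) * max 1 A𝒫')) ^ ((2 ^ (d + 1) + 2) ^ d * L ^ d) * (4 : ℝ) ^ ((2 ^ (d + 1) + 2) ^ d * L ^ d)) ≤ A ^ ((1 + 1 / ((2 * (2 ^ d + 1) + 6 : ℝ) ^ d)) - 1 : ℝ))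
    (hc2A : (kappaABKM d R A A𝒫' r) ^ (L ^ d) * ((2 * (kappaABKM d R A A𝒫' r) * max 1 A𝒫') ^ ((2 ^ (d + 1) + 2) ^ d * L ^ d) * (2 : ℝ) ^ ((2 ^ (d + 1) + 2) ^ d * L ^ d)) ≤ A ^ ((1 + 1 / ((2 * (2 ^ d + 1) + 6 : ℝ) ^ d)) - 1 : ℝ))
    {ρ : ℝ} (hρ0 : 0 ≤ ρ)
    (hqT₀ : 2 * (d : ℝ) ^ 2 / (((L ^ (d * 0) : ℕ) : ℝ) * (fieldWt h (L : ℝ) d 0 / (L : ℝ) ^ 0) ^ 2) * ρ ≤ T₀)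
    (x₀ : HamSpace ℂ d (fieldWt h (L : ℝ) d 0) ((L : ℝ) ^ 0) (L ^ (d * 0))) :
    RGFlow.IsRGStepQ (E := (fun k => HamSpace ℂ d (fieldWt h (L : ℝ) d k) ((L : ℝ) ^ k) (L ^ (d * k)))) (F := (fun k => activitySpace (abkmNormParams L N Mord R pT r₀ h θbar A (schedDelta δ₀ δ₁ N) fun j => 𝒞 1 j) k)) N r (3 / 4)
      ((L : ℝ) ^ d * (pi2BoundConst d (((2 * R + 2 : ℕ) : ℝ) + ((d / 2 + 1 : ℕ) : ℝ)) * (A𝒫' * A⁻¹)))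
      (sigmaABKM d L R A A𝒫' r) (activityNormLE (abkmNormParams L N Mord R pT r₀ h θbar A (schedDelta δ₀ δ₁ N) fun j => 𝒞 1 j))
      (rgA L h (fun j => 𝒞 ((1 : Matrix (Fin d) (Fin d) ℝ) + hamTuningMap ρ x₀) j))
      (rgBT hd hMord hMR hLodd hL hM hθbar hlam hn hn2 hnñ hc hC1 hallA hB pT r₀ hr₀ A hθ0 hθ hT₀ hKT₀ (hamTuningMap ρ x₀))
      (rgSQ (L := L) (N := N) (Mord := Mord) (R := R) (p := pT) (r₀ := r₀) (h := h) (θbar := θbar) (A := A)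
              (δ₀ := δ₀) (δ₁ := δ₁) (𝒞 := fun j => 𝒞 1 j) (fun j => 𝒞 ((1 : Matrix (Fin d) (Fin d) ℝ) + hamTuningMap ρ x₀) j)) := by
  have hh : 0 < h := Fact.out
  have hA𝒫0 : 0 ≤ A𝒫' := by
    rw [← hA𝒫']
    exact zero_le_one.trans (one_le_weightIntConstRho hθbar hθ0 hθ
      (traceConst_nonneg d Mord R hlam.le (derivSum_nonneg d n _)))
  have hq : (hamTuningMap ρ x₀).IsSymm := hamTuningMap_isSymm ρ x₀
  have hqT' : ∑ i, ∑ j, |hamTuningMap ρ x₀ i j| ≤ T₀ := (entrySum_hamTuningMap_le hρ0 x₀).trans hqT₀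
  have hS := stepKernelBounds_family_of_torusFRD hd hMord hMR hLodd hL hθbar hlam hn hn2 hnñ hc hC1 hallA hB
    hθ0 hθ hT₀ hKT₀ hq hqT'
  have hT := isRGStepQ_abkm_of_stepKernelBounds (p := pT)
    (𝒞s := fun j => 𝒞 ((1 : Matrix (Fin d) (Fin d) ℝ) + hamTuningMap ρ x₀) j) hd hLodd hL hR2 hM hp hpM hMR hr₀
    hB hδ₀ hδ₁ hh hh0 hS hh2 (hA𝒫' ▸ hA𝒫0) hA1 (hA𝒫' ▸ hA𝒫A) (hA𝒫' ▸ hsmall) hr0 hr (hA𝒫' ▸ hv) (hA𝒫' ▸ hωA)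
    (hA𝒫' ▸ hc3A) (hA𝒫' ▸ hc2A)
  simp only [rgBT_of_mem (h := h) hd hMord hMR hLodd hL hM hθbar hlam hn hn2 hnñ hc hC1 hallA hB pT r₀ hr₀ A hθ0 hθ
    hT₀ hKT₀ hq hqT']
  rw [← hA𝒫']
  exact hT

/-- **The `K_N`-slot of the last-scale functional, two points** (`hΦ1` of the abstract assembly, with
`c_I = A⁻¹A_𝒫`): for a seed `x₀` in the ball and admissible `N`-activities `y, y'` with
`‖y − y'‖_N ≤ c`, `‖Φ(x₀, y) − Φ(x₀, y')‖ ≤ (A⁻¹A_𝒫)·c` (`TunedFlowLastScale.norm_integral_last_sub_le_abkm`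
at the kernels `𝒞_{𝟙+q(x₀)}`). ([ABKM19] (4.12).) -/
theorem norm_lastScaleInt_sub_le {h : ℝ} [Fact (0 < h)] [Fact (0 < L)]
    (hd : 3 ≤ d) (hMord : 1 ≤ Mord) (hMR : Mord ≤ R) (hLodd : Odd L) (hL : 2 ^ (d + 3) + 16 * R ≤ L)
    (hM : M = L ^ N)
    (hθbar : 0 < θbar) (hlam : 0 < lam) (hn : 2 * Mord ≤ n) (hn2 : 2 ≤ n) (hnñ : n ≤ ñ)
    (hc : 0 < c) (hC1 : 0 ≤ Cℓ 1)
    (hallA : ∀ A : Matrix (Fin d) (Fin d) ℝ, IsElliptic (1 / 2 : ℝ) 2 A →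
        (∀ k, 1 ≤ k → k ≤ N + 1 →
          ∑ x : Fin d → ZMod M, 𝒞 A k x = 0 ∧ ∀ x, 𝒞 A k (-x) = 𝒞 A k x) ∧
        (∀ k, 1 ≤ k → k ≤ N + 1 → ∀ φ : (Fin d → ZMod M) → ℝ, ∑ x, φ x = 0 →
          0 ≤ ∑ x, ∑ y, φ x * 𝒞 A k (x - y) * φ y) ∧
        (∀ φ : (Fin d → ZMod M) → ℝ, ∑ x, φ x = 0 →
          ellOp A (conv (fun x => ∑ k ∈ Finset.Icc 1 (N + 1), 𝒞 A k x) φ) = φ) ∧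
        (∀ k, 1 ≤ k → k ≤ N → Mc k ≤ 0 ∧
          ∀ x : Fin d → ZMod M, ((L : ℝ) ^ k) / 2 ≤ (supNorm x : ℝ) →
            𝒞 A k x = Mc k) ∧
        (∀ k, 1 ≤ k → k ≤ N + 1 → ∀ B : Matrix (Fin d) (Fin d) ℝ, IsUnitSymm B →
          (∃ ε : ℝ, 0 < ε ∧ ∀ x : Fin d → ZMod M,
            ContDiffOn ℝ ⊤ (fun s : ℝ => 𝒞 (A + s • B) k x) (Set.Ioo (-ε) ε)) ∧
          ∀ α : Fin d → ℕ, ∑ i, α i ≤ n → ∀ ℓ : ℕ, ∀ x : Fin d → ZMod M,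
            abs (iteratedDeriv ℓ (fun s : ℝ => iterDiff α (𝒞 (A + s • B) k) x) 0)
              ≤ Cα α ℓ / (L : ℝ) ^ ((k - 1) * (d - 2 + ∑ i, α i))) ∧
        (∀ k, 1 ≤ k → k ≤ N + 1 → ∀ j : ℕ, ∀ κ : Fin d → ZMod M, κ ≠ 0 → InShell L j κ →
          (j < k →
            c / (L : ℝ) ^ (2 * (d + ñ) + 1) * (L : ℝ) ^ (2 * j)
                / (L : ℝ) ^ ((k - j) * (d - 1 + n)) ≤ (fourierCoeff (𝒞 A k) κ).re ∧
            ‖fourierCoeff (𝒞 A k) κ‖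
              ≤ C * (L : ℝ) ^ (2 * (d + ñ) + 1) * (L : ℝ) ^ (2 * j)
                  / (L : ℝ) ^ ((k - j) * (d - 1 + n))) ∧
          (k ≤ j →
            c / (L : ℝ) ^ (2 * (d + ñ) + 1) * (L : ℝ) ^ (2 * k)
                ≤ (fourierCoeff (𝒞 A k) κ).re ∧
            ‖fourierCoeff (𝒞 A k) κ‖ ≤ C * (L : ℝ) ^ (2 * k)) ∧
          ∀ B : Matrix (Fin d) (Fin d) ℝ, IsUnitSymm B → ∀ ℓ : ℕ, 1 ≤ ℓ →
            (j < k →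
              ‖iteratedDeriv ℓ (fun s : ℝ => fourierCoeff (𝒞 (A + s • B) k) κ) 0‖
                ≤ Cℓ ℓ * (L : ℝ) ^ (2 * (d + ñ) + 1) * (L : ℝ) ^ (2 * j)
                    / (L : ℝ) ^ ((k - j) * (d - 1 + ñ))) ∧
            (k ≤ j →
              ‖iteratedDeriv ℓ (fun s : ℝ => fourierCoeff (𝒞 (A + s • B) k) κ) 0‖
                ≤ Cℓ ℓ * (L : ℝ) ^ (2 * k))))
    (hB : AbkmWeightBounds L N Mord R n θbar lam μ δ₁ δ₀ A𝒫 (fun j => 𝒞 1 j)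
      (abkmWeightData L N Mord R θbar (schedDelta δ₀ δ₁ N) fun j => 𝒞 1 j))
    {pT r₀ : ℕ}
    {θ : ℝ} (hθ0 : 0 ≤ θ) (hθ : θ < θbar)
    {T₀ : ℝ} (hT₀ : T₀ ≤ 1 / 2) (hKT₀ : shellRatioConst c (Cℓ 1) (L : ℝ) d ñ * T₀ ≤ Real.log (1 + θ))
    {A𝒫' : ℝ} (hA𝒫' : weightIntConstRho θbar θ (traceConst d Mord R lam (derivSum d n fun θ' _ => Cα θ' 0)) = A𝒫')
    {A : ℝ} (hA1 : 1 ≤ A)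
    {ρ : ℝ} (hρ0 : 0 ≤ ρ)
    (hqT₀ : 2 * (d : ℝ) ^ 2 / (((L ^ (d * 0) : ℕ) : ℝ) * (fieldWt h (L : ℝ) d 0 / (L : ℝ) ^ 0) ^ 2) * ρ ≤ T₀)
    (x₀ : HamSpace ℂ d (fieldWt h (L : ℝ) d 0) ((L : ℝ) ^ 0) (L ^ (d * 0)))
    (y y' : activitySpace (abkmNormParams L N Mord R pT r₀ h θbar A (schedDelta δ₀ δ₁ N) fun j => 𝒞 1 j) N) {c' : ℝ}
    (hc' : activityNormLE (abkmNormParams L N Mord R pT r₀ h θbar A (schedDelta δ₀ δ₁ N) fun j => 𝒞 1 j) N (y - y') c') :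
    ‖(∫ φ, ((y : activitySpace (abkmNormParams L N Mord R pT r₀ h θbar A (schedDelta δ₀ δ₁ N) fun j => 𝒞 1 j) N) : Finset (Fin d → ZMod M) → ((Fin d → ZMod M) → ℝ) → ℂ) Finset.univ φ
          ∂(stepMeasure (𝒞 ((1 : Matrix (Fin d) (Fin d) ℝ) + hamTuningMap ρ x₀) (N + 1))))
        - (∫ φ, ((y' : activitySpace (abkmNormParams L N Mord R pT r₀ h θbar A (schedDelta δ₀ δ₁ N) fun j => 𝒞 1 j) N) : Finset (Fin d → ZMod M) → ((Fin d → ZMod M) → ℝ) → ℂ) Finset.univ φ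
          ∂(stepMeasure (𝒞 ((1 : Matrix (Fin d) (Fin d) ℝ) + hamTuningMap ρ x₀) (N + 1))))‖
      ≤ (A⁻¹ * A𝒫') * c' := by
  have hA : 0 < A := by linarith
  have hq : (hamTuningMap ρ x₀).IsSymm := hamTuningMap_isSymm ρ x₀
  have hqT' : ∑ i, ∑ j, |hamTuningMap ρ x₀ i j| ≤ T₀ := (entrySum_hamTuningMap_le hρ0 x₀).trans hqT₀
  have hSN := stepKernelBounds_one_add_of_torusFRD hd hMord hMR hLodd hL hθbar hlam hn hn2 hnñ hc hC1 hallA hB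
    (k := N) (by omega) hθ0 hθ hT₀ hKT₀ hq hqT'
  rw [hA𝒫'] at hSN
  have h := norm_integral_last_sub_le_abkm (p := pT) (r₀ := r₀)
    (𝒞s := fun j => 𝒞 ((1 : Matrix (Fin d) (Fin d) ℝ) + hamTuningMap ρ x₀) j) hLodd hM hB hSN hA y y' hc'
  calc _ ≤ c' * A⁻¹ * A𝒫' := h
    _ = (A⁻¹ * A𝒫') * c' := by ring

/-- **The `K_N`-slot of the last-scale functional, four points** (`hΦ4` of the abstract assembly, with
`c_I = A⁻¹A_𝒫`): `‖Σ± Φ(x₀, y_{ij})‖ ≤ (A⁻¹A_𝒫)·c` whenever `‖y₁₁ − y₁₀ − y₀₁ + y₀₀‖_N ≤ c`.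
([ABKM19] (4.12).) -/
theorem norm_lastScaleInt_secondDiff_le {h : ℝ} [Fact (0 < h)] [Fact (0 < L)]
    (hd : 3 ≤ d) (hMord : 1 ≤ Mord) (hMR : Mord ≤ R) (hLodd : Odd L) (hL : 2 ^ (d + 3) + 16 * R ≤ L)
    (hM : M = L ^ N)
    (hθbar : 0 < θbar) (hlam : 0 < lam) (hn : 2 * Mord ≤ n) (hn2 : 2 ≤ n) (hnñ : n ≤ ñ)
    (hc : 0 < c) (hC1 : 0 ≤ Cℓ 1)
    (hallA : ∀ A : Matrix (Fin d) (Fin d) ℝ, IsElliptic (1 / 2 : ℝ) 2 A →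
        (∀ k, 1 ≤ k → k ≤ N + 1 →
          ∑ x : Fin d → ZMod M, 𝒞 A k x = 0 ∧ ∀ x, 𝒞 A k (-x) = 𝒞 A k x) ∧
        (∀ k, 1 ≤ k → k ≤ N + 1 → ∀ φ : (Fin d → ZMod M) → ℝ, ∑ x, φ x = 0 →
          0 ≤ ∑ x, ∑ y, φ x * 𝒞 A k (x - y) * φ y) ∧
        (∀ φ : (Fin d → ZMod M) → ℝ, ∑ x, φ x = 0 →
          ellOp A (conv (fun x => ∑ k ∈ Finset.Icc 1 (N + 1), 𝒞 A k x) φ) = φ) ∧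
        (∀ k, 1 ≤ k → k ≤ N → Mc k ≤ 0 ∧
          ∀ x : Fin d → ZMod M, ((L : ℝ) ^ k) / 2 ≤ (supNorm x : ℝ) →
            𝒞 A k x = Mc k) ∧
        (∀ k, 1 ≤ k → k ≤ N + 1 → ∀ B : Matrix (Fin d) (Fin d) ℝ, IsUnitSymm B →
          (∃ ε : ℝ, 0 < ε ∧ ∀ x : Fin d → ZMod M,
            ContDiffOn ℝ ⊤ (fun s : ℝ => 𝒞 (A + s • B) k x) (Set.Ioo (-ε) ε)) ∧
          ∀ α : Fin d → ℕ, ∑ i, α i ≤ n → ∀ ℓ : ℕ, ∀ x : Fin d → ZMod M,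
            abs (iteratedDeriv ℓ (fun s : ℝ => iterDiff α (𝒞 (A + s • B) k) x) 0)
              ≤ Cα α ℓ / (L : ℝ) ^ ((k - 1) * (d - 2 + ∑ i, α i))) ∧
        (∀ k, 1 ≤ k → k ≤ N + 1 → ∀ j : ℕ, ∀ κ : Fin d → ZMod M, κ ≠ 0 → InShell L j κ →
          (j < k →
            c / (L : ℝ) ^ (2 * (d + ñ) + 1) * (L : ℝ) ^ (2 * j)
                / (L : ℝ) ^ ((k - j) * (d - 1 + n)) ≤ (fourierCoeff (𝒞 A k) κ).re ∧
            ‖fourierCoeff (𝒞 A k) κ‖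
              ≤ C * (L : ℝ) ^ (2 * (d + ñ) + 1) * (L : ℝ) ^ (2 * j)
                  / (L : ℝ) ^ ((k - j) * (d - 1 + n))) ∧
          (k ≤ j →
            c / (L : ℝ) ^ (2 * (d + ñ) + 1) * (L : ℝ) ^ (2 * k)
                ≤ (fourierCoeff (𝒞 A k) κ).re ∧
            ‖fourierCoeff (𝒞 A k) κ‖ ≤ C * (L : ℝ) ^ (2 * k)) ∧
          ∀ B : Matrix (Fin d) (Fin d) ℝ, IsUnitSymm B → ∀ ℓ : ℕ, 1 ≤ ℓ →
            (j < k →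
              ‖iteratedDeriv ℓ (fun s : ℝ => fourierCoeff (𝒞 (A + s • B) k) κ) 0‖
                ≤ Cℓ ℓ * (L : ℝ) ^ (2 * (d + ñ) + 1) * (L : ℝ) ^ (2 * j)
                    / (L : ℝ) ^ ((k - j) * (d - 1 + ñ))) ∧
            (k ≤ j →
              ‖iteratedDeriv ℓ (fun s : ℝ => fourierCoeff (𝒞 (A + s • B) k) κ) 0‖
                ≤ Cℓ ℓ * (L : ℝ) ^ (2 * k))))
    (hB : AbkmWeightBounds L N Mord R n θbar lam μ δ₁ δ₀ A𝒫 (fun j => 𝒞 1 j)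
      (abkmWeightData L N Mord R θbar (schedDelta δ₀ δ₁ N) fun j => 𝒞 1 j))
    {pT r₀ : ℕ}
    {θ : ℝ} (hθ0 : 0 ≤ θ) (hθ : θ < θbar)
    {T₀ : ℝ} (hT₀ : T₀ ≤ 1 / 2) (hKT₀ : shellRatioConst c (Cℓ 1) (L : ℝ) d ñ * T₀ ≤ Real.log (1 + θ))
    {A𝒫' : ℝ} (hA𝒫' : weightIntConstRho θbar θ (traceConst d Mord R lam (derivSum d n fun θ' _ => Cα θ' 0)) = A𝒫')
    {A : ℝ} (hA1 : 1 ≤ A)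
    {ρ : ℝ} (hρ0 : 0 ≤ ρ)
    (hqT₀ : 2 * (d : ℝ) ^ 2 / (((L ^ (d * 0) : ℕ) : ℝ) * (fieldWt h (L : ℝ) d 0 / (L : ℝ) ^ 0) ^ 2) * ρ ≤ T₀)
    (x₀ : HamSpace ℂ d (fieldWt h (L : ℝ) d 0) ((L : ℝ) ^ 0) (L ^ (d * 0)))
    (y₁₁ y₁₀ y₀₁ y₀₀ : activitySpace (abkmNormParams L N Mord R pT r₀ h θbar A (schedDelta δ₀ δ₁ N) fun j => 𝒞 1 j) N) {c' : ℝ}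
    (hc' : activityNormLE (abkmNormParams L N Mord R pT r₀ h θbar A (schedDelta δ₀ δ₁ N) fun j => 𝒞 1 j) N (y₁₁ - y₁₀ - y₀₁ + y₀₀) c') :
    ‖(∫ φ, ((y₁₁ : activitySpace (abkmNormParams L N Mord R pT r₀ h θbar A (schedDelta δ₀ δ₁ N) fun j => 𝒞 1 j) N) : Finset (Fin d → ZMod M) → ((Fin d → ZMod M) → ℝ) → ℂ) Finset.univ φ
          ∂(stepMeasure (𝒞 ((1 : Matrix (Fin d) (Fin d) ℝ) + hamTuningMap ρ x₀) (N + 1))))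
        - (∫ φ, ((y₁₀ : activitySpace (abkmNormParams L N Mord R pT r₀ h θbar A (schedDelta δ₀ δ₁ N) fun j => 𝒞 1 j) N) : Finset (Fin d → ZMod M) → ((Fin d → ZMod M) → ℝ) → ℂ) Finset.univ φ
          ∂(stepMeasure (𝒞 ((1 : Matrix (Fin d) (Fin d) ℝ) + hamTuningMap ρ x₀) (N + 1))))
        - (∫ φ, ((y₀₁ : activitySpace (abkmNormParams L N Mord R pT r₀ h θbar A (schedDelta δ₀ δ₁ N) fun j => 𝒞 1 j) N) : Finset (Fin d → ZMod M) → ((Fin d → ZMod M) → ℝ) → ℂ) Finset.univ φ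
          ∂(stepMeasure (𝒞 ((1 : Matrix (Fin d) (Fin d) ℝ) + hamTuningMap ρ x₀) (N + 1))))
        + (∫ φ, ((y₀₀ : activitySpace (abkmNormParams L N Mord R pT r₀ h θbar A (schedDelta δ₀ δ₁ N) fun j => 𝒞 1 j) N) : Finset (Fin d → ZMod M) → ((Fin d → ZMod M) → ℝ) → ℂ) Finset.univ φ
          ∂(stepMeasure (𝒞 ((1 : Matrix (Fin d) (Fin d) ℝ) + hamTuningMap ρ x₀) (N + 1))))‖
      ≤ (A⁻¹ * A𝒫') * c' := by
  have hA : 0 < A := by linarith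
  have hq : (hamTuningMap ρ x₀).IsSymm := hamTuningMap_isSymm ρ x₀
  have hqT' : ∑ i, ∑ j, |hamTuningMap ρ x₀ i j| ≤ T₀ := (entrySum_hamTuningMap_le hρ0 x₀).trans hqT₀
  have hSN := stepKernelBounds_one_add_of_torusFRD hd hMord hMR hLodd hL hθbar hlam hn hn2 hnñ hc hC1 hallA hB
    (k := N) (by omega) hθ0 hθ hT₀ hKT₀ hq hqT'
  rw [hA𝒫'] at hSN
  have h := norm_integral_last_secondDiff_le_abkm (p := pT) (r₀ := r₀)
    (𝒞s := fun j => 𝒞 ((1 : Matrix (Fin d) (Fin d) ℝ) + hamTuningMap ρ x₀) j) hLodd hM hB hSN hA y₁₁ y₁₀ y₀₁ y₀₀ hc'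
  calc _ ≤ c' * A⁻¹ * A𝒫' := h
    _ = (A⁻¹ * A𝒫') * c' := by ring

end Package

end Summit.HubbardSuperconductivity.HubbardSuperconductivity.Theorems.ComplexGFF

end
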